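import Mathlib
import HarnessLib
import HarnessLib.Audit
import Summits.Langlands.Statement
import Summits.Langlands.Langlands.Theses.RootDecomp1
import Summits.Langlands.Langlands.Theses.CyclicDeinductionCarving

/-! BC3 birth skeleton for crux `ConjugateUnmixing` (UNMIX) of the child route CyclicDeinductionCarving (lens-3 g17; refines RootDecomp1:DarkPrimitiveAvatars 29147).
POST-BIRTH form: concludes the ROUTE decl by name.
Stubs: stub_unmixAccessible, stub_unmixDark — each a genuine theorem-sized piece (population split), none restates the crux or the summit (probes: probes/). `ConjugateUnmixing_of` is proved (case split); sorries ONLY inside `stub_*`. -/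

set_option linter.unusedVariables false
set_option linter.dupNamespace false

namespace Summit.Langlands.Langlands.Cruxes.ConjugateUnmixing.Birth

open scoped BigOperators Topology Manifold Classical MeasureTheory ProbabilityTheory Matrix InnerProductSpace ComplexConjugate ContinuousMap
open Filter Set Function TopologicalSpace MeasureTheory

open Summit.Langlands.Langlands.Theses.CyclicDeinductionCarving (ConjugateUnmixing)

/-- UNMIX over an ACCESSIBLE field K ([K:K⁺] ≤ 2): PROVABLE FROM THE SIBLING ITEM Acc = RootDecomp1.AccessibleAvatars 29148 (the avatar exists outright, the pre-avatar hypothesis is discarded) — recorded so that no prover spends time here; inside Acc's scope (CM/TR regular: print, HLTT/Scholze; mixed-signature or irregular: open as Acc). -/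
theorem stub_unmixAccessible :
    ∀ (K₀ : Type) [Field K₀] [NumberField K₀] (K : Type) [Field K] [NumberField K] [Algebra K₀ K], IsGalois K₀ K → IsCyclic (K ≃ₐ[K₀] K) → (Module.finrank K₀ K).Prime → Module.finrank (NumberField.maximalRealSubfield K) K ≤ 2 → ∀ (m : ℕ) (hK : Literature.NumberTheory.Automorphic.isCompact_glFiniteIntegralLevel m K), 0 < m → ∀ (π : Literature.NumberTheory.Automorphic.CuspidalAutomorphicRepData m K hK), π.1.IsLAlgebraic → ∀ (ℓ : ℕ) [Fact ℓ.Prime] (ι : PadicAlgCl ℓ ≃+* ℂ), (∃ r : Literature.NumberTheory.GaloisRepresentations.FramedGaloisRep K (PadicAlgCl ℓ) m, r.toGaloisRep.IsSemisimple ∧ (∀ᶠ v : IsDedekindDomain.HeightOneSpectrum (NumberField.RingOfIntegers K₀) in cofinite, ∀ β : IsDedekindDomain.HeightOneSpectrum (NumberField.RingOfIntegers K) → Multiset ℂ, (∀ w : IsDedekindDomain.HeightOneSpectrum (NumberField.RingOfIntegers K), w.asIdeal.under (NumberField.RingOfIntegers K₀) = v.asIdeal → π.1.HasSatakeParamAt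 w (β w)) → ∃ Q : IsDedekindDomain.HeightOneSpectrum (NumberField.RingOfIntegers K) → Polynomial (PadicAlgCl ℓ), (∀ w : IsDedekindDomain.HeightOneSpectrum (NumberField.RingOfIntegers K), w.asIdeal.under (NumberField.RingOfIntegers K₀) = v.asIdeal → r.IsUnramifiedAt w ∧ r.HasFrobCharpolyAt w (Q w)) ∧ ∏ᶠ w ∈ {w : IsDedekindDomain.HeightOneSpectrum (NumberField.RingOfIntegers K) | w.asIdeal.under (NumberField.RingOfIntegers K₀) = v.asIdeal}, (Q w).comp (Polynomial.X ^ w.asIdeal.inertiaDeg (NumberField.RingOfIntegers K₀)) = ∏ᶠ w ∈ {w : IsDedekindDomain.HeightOneSpectrum (NumberField.RingOfIntegers K) | w.asIdeal.under (NumberField.RingOfIntegers K₀) = v.asIdeal}, (Literature.NumberTheory.Automorphic.arithFrobPolyOfSatake ι w.residueCard 1 (β w)).comp (Polynomial.X ^ w.asIdeal.inertiaDeg (NumberField.RingOfIntegers K₀)))) → ∃ ρ : Literature.NumberTheory.GaloisRepresentations.FramedGaloisRep K (PadicAlgCl ℓ) m, ρ.toGaloisRep.IsSemisimple ∧ ∀ᶠ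 w : IsDedekindDomain.HeightOneSpectrum (NumberField.RingOfIntegers K) in cofinite, SatakeFrobCompatibleAt ι π.1 ρ w := by
  sorry

/-- UNMIX over a DARK field K ([K:K⁺] ≥ 3) — THE ATOM PROPER (IDEA-NEEDED): unmix a semisimple pre-avatar r of π along the cyclic prime layer K/K₀ into an avatar. Floor m = 1 proved (node `unmixing_rankOne`, Weil); inert-place truncation proved for every m (node `preAvatar_compatible_of_unique_over`); the content is the alignment of the Galois partition {r^{σ^i}(Frob)} with the automorphic partition {π^{σ^i}} at the places split in K/K₀ (density 1/p). First idea for the ideation seat: poly-layer rigidity — pre-avatars along several cyclic layers K/K₀^{(j)} agree with π on the union of the inert sets and with each other there (Rajan 1998: density > 1 − 1/2m² ⇒ ≅), which pins ONE semisimple r compatible with π off the places split in every layer; the residue is a finite-index combinatorial unmixing. -/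
theorem stub_unmixDark :
    ∀ (K₀ : Type) [Field K₀] [NumberField K₀] (K : Type) [Field K] [NumberField K] [Algebra K₀ K], IsGalois K₀ K → IsCyclic (K ≃ₐ[K₀] K) → (Module.finrank K₀ K).Prime → ¬ Module.finrank (NumberField.maximalRealSubfield K) K ≤ 2 → ∀ (m : ℕ) (hK : Literature.NumberTheory.Automorphic.isCompact_glFiniteIntegralLevel m K), 0 < m → ∀ (π : Literature.NumberTheory.Automorphic.CuspidalAutomorphicRepData m K hK), π.1.IsLAlgebraic → ∀ (ℓ : ℕ) [Fact ℓ.Prime] (ι : PadicAlgCl ℓ ≃+* ℂ), (∃ r : Literature.NumberTheory.GaloisRepresentations.FramedGaloisRep K (PadicAlgCl ℓ) m, r.toGaloisRep.IsSemisimple ∧ (∀ᶠ v : IsDedekindDomain.HeightOneSpectrum (NumberField.RingOfIntegers K₀) in cofinite, ∀ β : IsDedekindDomain.HeightOneSpectrum (NumberField.RingOfIntegers K) → Multiset ℂ, (∀ w : IsDedekindDomain.HeightOneSpectrum (NumberField.RingOfIntegers K), w.asIdeal.under (NumberField.RingOfIntegers K₀) = v.asIdeal → π.1.HasSatakeParamAt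 w (β w)) → ∃ Q : IsDedekindDomain.HeightOneSpectrum (NumberField.RingOfIntegers K) → Polynomial (PadicAlgCl ℓ), (∀ w : IsDedekindDomain.HeightOneSpectrum (NumberField.RingOfIntegers K), w.asIdeal.under (NumberField.RingOfIntegers K₀) = v.asIdeal → r.IsUnramifiedAt w ∧ r.HasFrobCharpolyAt w (Q w)) ∧ ∏ᶠ w ∈ {w : IsDedekindDomain.HeightOneSpectrum (NumberField.RingOfIntegers K) | w.asIdeal.under (NumberField.RingOfIntegers K₀) = v.asIdeal}, (Q w).comp (Polynomial.X ^ w.asIdeal.inertiaDeg (NumberField.RingOfIntegers K₀)) = ∏ᶠ w ∈ {w : IsDedekindDomain.HeightOneSpectrum (NumberField.RingOfIntegers K) | w.asIdeal.under (NumberField.RingOfIntegers K₀) = v.asIdeal}, (Literature.NumberTheory.Automorphic.arithFrobPolyOfSatake ι w.residueCard 1 (β w)).comp (Polynomial.X ^ w.asIdeal.inertiaDeg (NumberField.RingOfIntegers K₀)))) → ∃ ρ : Literature.NumberTheory.GaloisRepresentations.FramedGaloisRep K (PadicAlgCl ℓ) m, ρ.toGaloisRep.IsSemisimple ∧ ∀ᶠ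 w : IsDedekindDomain.HeightOneSpectrum (NumberField.RingOfIntegers K) in cofinite, SatakeFrobCompatibleAt ι π.1 ρ w := by
  sorry

/-- the composition: the stubs imply the crux (population case split). -/
theorem ConjugateUnmixing_of :
    (∀ (K₀ : Type) [Field K₀] [NumberField K₀] (K : Type) [Field K] [NumberField K] [Algebra K₀ K], IsGalois K₀ K → IsCyclic (K ≃ₐ[K₀] K) → (Module.finrank K₀ K).Prime → Module.finrank (NumberField.maximalRealSubfield K) K ≤ 2 → ∀ (m : ℕ) (hK : Literature.NumberTheory.Automorphic.isCompact_glFiniteIntegralLevel m K), 0 < m → ∀ (π : Literature.NumberTheory.Automorphic.CuspidalAutomorphicRepData m K hK), π.1.IsLAlgebraic → ∀ (ℓ : ℕ) [Fact ℓ.Prime] (ι : PadicAlgCl ℓ ≃+* ℂ), (∃ r : Literature.NumberTheory.GaloisRepresentations.FramedGaloisRep K (PadicAlgCl ℓ) m, r.toGaloisRep.IsSemisimple ∧ (∀ᶠ v : IsDedekindDomain.HeightOneSpectrum (NumberField.RingOfIntegers K₀) in cofinite, ∀ β : IsDedekindDomain.HeightOneSpectrum (NumberField.RingOfIntegers K)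 → Multiset ℂ, (∀ w : IsDedekindDomain.HeightOneSpectrum (NumberField.RingOfIntegers K), w.asIdeal.under (NumberField.RingOfIntegers K₀) = v.asIdeal → π.1.HasSatakeParamAt w (β w)) → ∃ Q : IsDedekindDomain.HeightOneSpectrum (NumberField.RingOfIntegers K) → Polynomial (PadicAlgCl ℓ), (∀ w : IsDedekindDomain.HeightOneSpectrum (NumberField.RingOfIntegers K), w.asIdeal.under (NumberField.RingOfIntegers K₀) = v.asIdeal → r.IsUnramifiedAt w ∧ r.HasFrobCharpolyAt w (Q w)) ∧ ∏ᶠ w ∈ {w : IsDedekindDomain.HeightOneSpectrum (NumberField.RingOfIntegers K) | w.asIdeal.under (NumberField.RingOfIntegers K₀) = v.asIdeal}, (Q w).comp (Polynomial.X ^ w.asIdeal.inertiaDeg (NumberField.RingOfIntegers K₀)) = ∏ᶠ w ∈ {w : IsDedekindDomain.HeightOneSpectrum (NumberField.RingOfIntegers K) | w.asIdeal.under (NumberField.RingOfIntegers K₀) = v.asIdeal}, (Literature.NumberTheory.Automorphic.arithFrobPolyOfSatake ι w.residueCard 1 (β w)).comp (Polynomial.X ^ w.asIdeal.inertiaDeg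 (NumberField.RingOfIntegers K₀)))) → ∃ ρ : Literature.NumberTheory.GaloisRepresentations.FramedGaloisRep K (PadicAlgCl ℓ) m, ρ.toGaloisRep.IsSemisimple ∧ ∀ᶠ w : IsDedekindDomain.HeightOneSpectrum (NumberField.RingOfIntegers K) in cofinite, SatakeFrobCompatibleAt ι π.1 ρ w) →
    (∀ (K₀ : Type) [Field K₀] [NumberField K₀] (K : Type) [Field K] [NumberField K] [Algebra K₀ K], IsGalois K₀ K → IsCyclic (K ≃ₐ[K₀] K) → (Module.finrank K₀ K).Prime → ¬ Module.finrank (NumberField.maximalRealSubfield K) K ≤ 2 → ∀ (m : ℕ) (hK : Literature.NumberTheory.Automorphic.isCompact_glFiniteIntegralLevel m K), 0 < m → ∀ (π : Literature.NumberTheory.Automorphic.CuspidalAutomorphicRepData m K hK), π.1.IsLAlgebraic → ∀ (ℓ : ℕ) [Fact ℓ.Prime] (ι : PadicAlgCl ℓ ≃+* ℂ), (∃ r : Literature.NumberTheory.GaloisRepresentations.FramedGaloisRep K (PadicAlgCl ℓ) m, r.toGaloisRep.IsSemisimple ∧ (∀ᶠ v : IsDedekindDomain.HeightOneSpectrum (NumberField.RingOfIntegers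 K₀) in cofinite, ∀ β : IsDedekindDomain.HeightOneSpectrum (NumberField.RingOfIntegers K) → Multiset ℂ, (∀ w : IsDedekindDomain.HeightOneSpectrum (NumberField.RingOfIntegers K), w.asIdeal.under (NumberField.RingOfIntegers K₀) = v.asIdeal → π.1.HasSatakeParamAt w (β w)) → ∃ Q : IsDedekindDomain.HeightOneSpectrum (NumberField.RingOfIntegers K) → Polynomial (PadicAlgCl ℓ), (∀ w : IsDedekindDomain.HeightOneSpectrum (NumberField.RingOfIntegers K), w.asIdeal.under (NumberField.RingOfIntegers K₀) = v.asIdeal → r.IsUnramifiedAt w ∧ r.HasFrobCharpolyAt w (Q w)) ∧ ∏ᶠ w ∈ {w : IsDedekindDomain.HeightOneSpectrum (NumberField.RingOfIntegers K) | w.asIdeal.under (NumberField.RingOfIntegers K₀) = v.asIdeal}, (Q w).comp (Polynomial.X ^ w.asIdeal.inertiaDeg (NumberField.RingOfIntegers K₀)) = ∏ᶠ w ∈ {w : IsDedekindDomain.HeightOneSpectrum (NumberField.RingOfIntegers K) | w.asIdeal.under (NumberField.RingOfIntegers K₀) = v.asIdeal}, (Literature.NumberTheory.Automorphic.arithFrobPolyOfSatake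 ι w.residueCard 1 (β w)).comp (Polynomial.X ^ w.asIdeal.inertiaDeg (NumberField.RingOfIntegers K₀)))) → ∃ ρ : Literature.NumberTheory.GaloisRepresentations.FramedGaloisRep K (PadicAlgCl ℓ) m, ρ.toGaloisRep.IsSemisimple ∧ ∀ᶠ w : IsDedekindDomain.HeightOneSpectrum (NumberField.RingOfIntegers K) in cofinite, SatakeFrobCompatibleAt ι π.1 ρ w) →
    ConjugateUnmixing := by
  intro h1 h2 K₀ _ _ K _ _ _ hG hC hP
  by_cases hacc : Module.finrank (NumberField.maximalRealSubfield K) K ≤ 2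
  · exact h1 K₀ K hG hC hP hacc
  · exact h2 K₀ K hG hC hP hacc

theorem ConjugateUnmixing_holds : ConjugateUnmixing := ConjugateUnmixing_of stub_unmixAccessible stub_unmixDark

theorem ConjugateUnmixing_proof : Summit.Langlands.Langlands.Theses.CyclicDeinductionCarving.ConjugateUnmixing := ConjugateUnmixing_holds

end Summit.Langlands.Langlands.Cruxes.ConjugateUnmixing.Birth
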